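import Summits.QuantumFields.YangMills.Theorems.UnitScaleTiltFluctuationComparisonRegPrAnsatzTRows

/-!
# Route `UnitScaleTilt` — crux K1bR-pr `FluctuationComparisonRegPrL` (stmt-QuantumFields-19935, ex 19201), stub `stub_oneStepSmallLift`
# (W7 line), «ANSATZ T» part 3d — THE ROW BOUND OF THE TENSOR TABLE, orientations `(0,2)` and `(1,2)`
# (support file `--supports stmt-QuantumFields-19935`)

Cell `ym3-torus` (rung R3), seat `ym3-torus-p2` gen 10 (IR-NODE §16).  As `rowT01` in `…AnsatzTRows`: `(0,2)` has `H₂ = −(P¹⊗h⊗J¹)`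
(so `T = J₂ + (P¹⊗h⊗J¹)∘d2`), `(1,2)` has `H₂ = h⊗J¹⊗J¹`; the componentwise identities use `∂h = J¹ − P¹`, `h∂ = J⁰ − P⁰`,
`∂J⁰ = J¹∂`, `∂P⁰ = P¹∂` in the slots where the fine shift / coarse difference acts.

Elementary; nothing of Bałaban's is asserted.
-/

noncomputable section

open scoped BigOperators Matrix.Norms.L2Operator

namespace Summit.QuantumFields.YangMills.Theorems.ApproxLift.AnsatzT

open Literature.MathematicalPhysics.QuantumFieldTheory.Balaban1983to89
open T4Continuum BlockAveraging
open AnsatzS (P3 o01 o02 o12 sum_orient3)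

section Rows

variable {n : Type*} [Fintype n] [DecidableEq n]
variable {L m K : ℕ} {hL : Odd L ∧ 1 < L}

/-- Corner values of `P¹ ⊗ P⁰ ⊗ P¹`. -/
theorem P1_P0_P1_corner (h : ℕ) (q : ℕ) (a b c : ℤ) :
    P1 h (2 * h) a * P0 h q b * P1 h (2 * h) c = if a = 0 ∧ b = 0 ∧ c = 0 then 1 else 0 := by
  unfold P1 P0 mk3 P1z P0z
  by_cases ha : a = 0 <;> by_cases hb : b = 0 <;> by_cases hc : c = 0 <;> simp [ha, hb, hc]

/-- Corner values of `P⁰ ⊗ P¹ ⊗ P¹`. -/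
theorem P0_P1_P1_corner (h : ℕ) (q : ℕ) (a b c : ℤ) :
    P0 h q a * P1 h (2 * h) b * P1 h (2 * h) c = if a = 0 ∧ b = 0 ∧ c = 0 then 1 else 0 := by
  unfold P1 P0 mk3 P1z P0z
  by_cases ha : a = 0 <;> by_cases hb : b = 0 <;> by_cases hc : c = 0 <;> simp [ha, hb, hc]

omit [Fintype n] [DecidableEq n] in
/-- **THE EDGE TERM AS A BOX FUNCTIONAL**, orientation `(0,2)`. -/
theorem edge02_eq (hodd : Odd L) (pp : Fin 3 → Fin L) (w : Orient 3 → (Fin 3 → ℤ) → Matrix n n ℂ) :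
    (if exbC (P := P3 L m K hL) pp 0 = true ∧ exbC (P := P3 L m K hL) pp 2 = true then w o02 0 else 0) =
      boxSum (fun a b c => P1 (L / 2) (pp 0) a * P0 (L / 2) (pp 1) b * P1 (L / 2) (pp 2) c) (w o02) := by
  have hodd' : 2 * (L / 2) + 1 = L := by obtain ⟨t, ht⟩ := hodd; omega
  by_cases e0 : ((pp 0 : Fin L) : ℕ) = L - 1
  · by_cases e2 : ((pp 2 : Fin L) : ℕ) = L - 1
    · have q : L - 1 = 2 * (L / 2) := by omega
      simp only [exbC, e0, e2, decide_true, and_self, if_true]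
      rw [boxSum_congr (w o02) (fun a b c _ _ _ => by rw [q, P1_P0_P1_corner]), boxSum_single, Complex.ofReal_one, one_smul]
    · simp only [exbC, e0, e2, decide_true, decide_false, Bool.false_eq_true, and_false, if_false]
      rw [boxSum_congr (w o02) (fun a b c _ _ _ => by rw [P1_of_ne (p := (pp 2 : ℕ)) (by omega) c, mul_zero]), boxSum_zero]
  · simp only [exbC, e0, decide_false, Bool.false_eq_true, false_and, if_false]
    rw [boxSum_congr (w o02) (fun a b c _ _ _ => by rw [P1_of_ne (p := (pp 0 : ℕ)) (by omega) a, zero_mul, zero_mul]), boxSum_zero]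

omit [Fintype n] [DecidableEq n] in
/-- **THE EDGE TERM AS A BOX FUNCTIONAL**, orientation `(1,2)`. -/
theorem edge12_eq (hodd : Odd L) (pp : Fin 3 → Fin L) (w : Orient 3 → (Fin 3 → ℤ) → Matrix n n ℂ) :
    (if exbC (P := P3 L m K hL) pp 1 = true ∧ exbC (P := P3 L m K hL) pp 2 = true then w o12 0 else 0) =
      boxSum (fun a b c => P0 (L / 2) (pp 0) a * P1 (L / 2) (pp 1) b * P1 (L / 2) (pp 2) c) (w o12) := by
  have hodd' : 2 * (L / 2) + 1 = L := by obtain ⟨t, ht⟩ := hodd; omega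
  by_cases e1 : ((pp 1 : Fin L) : ℕ) = L - 1
  · by_cases e2 : ((pp 2 : Fin L) : ℕ) = L - 1
    · have q : L - 1 = 2 * (L / 2) := by omega
      simp only [exbC, e1, e2, decide_true, and_self, if_true]
      rw [boxSum_congr (w o12) (fun a b c _ _ _ => by rw [q, P0_P1_P1_corner]), boxSum_single, Complex.ofReal_one, one_smul]
    · simp only [exbC, e1, e2, decide_true, decide_false, Bool.false_eq_true, and_false, if_false]
      rw [boxSum_congr (w o12) (fun a b c _ _ _ => by rw [P1_of_ne (p := (pp 2 : ℕ)) (by omega) c, mul_zero]), boxSum_zero]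
  · simp only [exbC, e1, decide_false, Bool.false_eq_true, false_and, if_false]
    rw [boxSum_congr (w o12) (fun a b c _ _ _ => by rw [P1_of_ne (p := (pp 1 : ℕ)) (by omega) b, mul_zero, zero_mul]), boxSum_zero]

/-- **ROW `(0,2)` OF THE TENSOR TABLE**: `‖[edge] + rowFormC‖ ≤ (18/L²)·B_w + 1·B_d` (odd `L ≥ 3`). -/
theorem rowT02 (hodd : Odd L) (h3 : 3 ≤ L) (pp : Fin 3 → Fin L) (w : Orient 3 → (Fin 3 → ℤ) → Matrix n n ℂ) {Bw Bd : ℝ}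
    (hw : ∀ o s, ‖w o s‖ ≤ Bw)
    (hd : ∀ s : Fin 3 → ℤ, (∀ i, (s i).natAbs ≤ 1 + 1) → ‖d2 w 0 1 2 o01.2 o12.2 s‖ ≤ Bd) (hBw : 0 ≤ Bw) (hBd : 0 ≤ Bd) :
    ‖(if exbC (P := P3 L m K hL) pp 0 = true ∧ exbC (P := P3 L m K hL) pp 2 = true then w o02 0 else 0) +
        rowFormC (P := P3 L m K hL) 1 (kzT L) pp 0 2 w‖ ≤ (18 / (L : ℝ) ^ 2) * Bw + 1 * Bd := by
  set h := L / 2 with hdef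
  have h1 : 1 ≤ h := by omega
  have hodd' : 2 * h + 1 = L := by obtain ⟨t, ht⟩ := hodd; omega
  have hp : ∀ i, ((pp i : Fin L) : ℕ) ≤ 2 * h := fun i => by have := (pp i).isLt; omega
  have hLr : Lr h = L := by unfold Lr; exact_mod_cast hodd'
  have fh : ∀ (p : ℕ) (j : ℤ), p ≤ 2 * h → τ L (hh h) p j = hh h p j + (J1 h p j - P1 h p j) := fun p j hpj => by
    rw [τ_eq, ← hodd', fδ_hh h1 hpj]
  have fP : ∀ (p : ℕ) (j : ℤ), p ≤ 2 * h → τ L (P0 h) p j = P0 h p j + (P1 h p (j - 1) - P1 h p j) := fun p j hpj => by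
    rw [τ_eq, ← hodd', fδ_P0 h1 hpj]; rfl
  have fJ : ∀ (p : ℕ) (j : ℤ), p ≤ 2 * h → τ L (J0 h) p j = J0 h p j + (J1 h p (j - 1) - J1 h p j) := fun p j hpj => by
    rw [τ_eq, ← hodd', fδ_J0 h1 hpj]; rfl
  have ch : ∀ (p : ℕ) (j : ℤ), hh h p (j - 1) = hh h p j + (J0 h p j - P0 h p j) := fun p j => by
    have := cΔ_hh (h := h) (p := p) j; unfold cΔ at this; linarith
  have o2 : (2:ℤ) ≤ |(2:ℤ)| := by norm_num
  have o3 : (2:ℤ) ≤ |(-3:ℤ)| := by norm_num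
  -- Step A
  rw [rowFormC, edge02_eq (hL := hL) hodd]
  simp only [sum_orient3, kzT]
  rw [AnsatzS.succOff_ne pp (show (1 : Fin 3) ≠ 0 by decide), AnsatzS.succOff_ne pp (show (2 : Fin 3) ≠ 0 by decide),
    AnsatzS.succOff_ne pp (show (0 : Fin 3) ≠ 2 by decide), AnsatzS.succOff_ne pp (show (1 : Fin 3) ≠ 2 by decide),
    AnsatzS.succOff_val_self, AnsatzS.succOff_val_self]
  simp (decide := true) only [tabT, Fin.isValue, Fin.val_zero, Fin.val_two, and_self, and_true, and_false,
    if_true, if_false, Complex.ofReal_neg, neg_smul, Finset.sum_neg_distrib, Complex.ofReal_zero, zero_smul,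
    Finset.sum_const_zero, add_zero, zero_add]
  rw [← hdef]
  rw [term_plain (KSupp.P1 h) (KSupp.hh h) (KSupp.J0 h), term_plain (KSupp.P1 h) (KSupp.P0 h) (KSupp.hh h),
    term_shift0 (hL := hL) (KSupp.hh h) (KSupp.J0 h) (KSupp.J1 h), term_shift0 (hL := hL) (KSupp.P0 h) (KSupp.hh h) (KSupp.J1 h),
    term_shift2 (hL := hL) (KSupp.P1 h) (KSupp.hh h) (KSupp.J0 h), term_shift2 (hL := hL) (KSupp.P1 h) (KSupp.P0 h) (KSupp.hh h),
    term_plain (KSupp.hh h) (KSupp.J0 h) (KSupp.J1 h), term_plain (KSupp.P0 h) (KSupp.hh h) (KSupp.J1 h)]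
  -- Step B
  set E := boxSum (fun a b c => P1 h (pp 0) a * P0 h (pp 1) b * P1 h (pp 2) c) (w o02) with hE
  set B1a := boxSum (fun a b c => P1 h (pp 0) a * hh h (pp 1) b * J0 h (pp 2) c) (w o01) with hB1a
  set B1b := boxSum (fun a b c => P1 h (pp 0) a * P0 h (pp 1) b * hh h (pp 2) c) (w o02) with hB1b
  set B2b := boxSum (fun a b c => τ L (hh h) (pp 0) a * J0 h (pp 1) b * J1 h (pp 2) c) (w o02) with hB2b
  set B2c := boxSum (fun a b c => τ L (P0 h) (pp 0) a * hh h (pp 1) b * J1 h (pp 2) c) (w o12) with hB2c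
  set B3a := boxSum (fun a b c => P1 h (pp 0) a * hh h (pp 1) b * τ L (J0 h) (pp 2) c) (w o01) with hB3a
  set B3b := boxSum (fun a b c => P1 h (pp 0) a * P0 h (pp 1) b * τ L (hh h) (pp 2) c) (w o02) with hB3b
  set B4b := boxSum (fun a b c => hh h (pp 0) a * J0 h (pp 1) b * J1 h (pp 2) c) (w o02) with hB4b
  set B4c := boxSum (fun a b c => P0 h (pp 0) a * hh h (pp 1) b * J1 h (pp 2) c) (w o12) with hB4c
  set BJ := boxSum (fun a b c => J1 h (pp 0) a * J0 h (pp 1) b * J1 h (pp 2) c) (w o02) with hBJ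
  set BHD := boxSum (fun a b c => P1 h (pp 0) a * hh h (pp 1) b * J1 h (pp 2) c) (fun v => d2 w 0 1 2 o01.2 o12.2 v) with hBHD
  have hD : BHD = boxSum (fun a b c => P1 h (pp 0) (a - 1) * hh h (pp 1) b * J1 h (pp 2) c) (w o12)
      - boxSum (fun a b c => P1 h (pp 0) a * hh h (pp 1) b * J1 h (pp 2) c) (w o12)
      - (boxSum (fun a b c => P1 h (pp 0) a * hh h (pp 1) (b - 1) * J1 h (pp 2) c) (w o02)
        - boxSum (fun a b c => P1 h (pp 0) a * hh h (pp 1) b * J1 h (pp 2) c) (w o02))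
      + (boxSum (fun a b c => P1 h (pp 0) a * hh h (pp 1) b * J1 h (pp 2) (c - 1)) (w o01)
        - boxSum (fun a b c => P1 h (pp 0) a * hh h (pp 1) b * J1 h (pp 2) c) (w o01)) := by
    rw [hBHD, boxSum_d2' _ w (fun b c => by simp [KSupp.P1 h _ _ o2]) (fun b c => by simp [KSupp.P1 h _ _ o3])
      (fun a c => by simp [KSupp.hh h _ _ o2]) (fun a c => by simp [KSupp.hh h _ _ o3])
      (fun a b => by simp [KSupp.J1 h _ _ o2]) (fun a b => by simp [KSupp.J1 h _ _ o3])]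
    simp only [boxSum_sub]
  -- Step C
  have g02 : E - B1b + B2b + B3b - B4b = BJ - (boxSum (fun a b c => P1 h (pp 0) a * hh h (pp 1) (b - 1) * J1 h (pp 2) c) (w o02)
        - boxSum (fun a b c => P1 h (pp 0) a * hh h (pp 1) b * J1 h (pp 2) c) (w o02)) := by
    have key := boxSum_congr (w o02)
      (F := fun a b c => P1 h (pp 0) a * P0 h (pp 1) b * P1 h (pp 2) c - P1 h (pp 0) a * P0 h (pp 1) b * hh h (pp 2) c
        + τ L (hh h) (pp 0) a * J0 h (pp 1) b * J1 h (pp 2) c + P1 h (pp 0) a * P0 h (pp 1) b * τ L (hh h) (pp 2) c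
        - hh h (pp 0) a * J0 h (pp 1) b * J1 h (pp 2) c)
      (G := fun a b c => J1 h (pp 0) a * J0 h (pp 1) b * J1 h (pp 2) c
        - (P1 h (pp 0) a * hh h (pp 1) (b - 1) * J1 h (pp 2) c - P1 h (pp 0) a * hh h (pp 1) b * J1 h (pp 2) c))
      (fun a b c _ _ _ => by rw [fh _ _ (hp 0), fh _ _ (hp 2), ch]; ring)
    simp only [boxSum_add, boxSum_sub] at key
    rw [hE, hB1b, hB2b, hB3b, hB4b, hBJ]; exact key
  have g01 : -B1a + B3a = boxSum (fun a b c => P1 h (pp 0) a * hh h (pp 1) b * J1 h (pp 2) (c - 1)) (w o01)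
        - boxSum (fun a b c => P1 h (pp 0) a * hh h (pp 1) b * J1 h (pp 2) c) (w o01) := by
    have key := boxSum_congr (w o01)
      (F := fun a b c => -(P1 h (pp 0) a * hh h (pp 1) b * J0 h (pp 2) c) + P1 h (pp 0) a * hh h (pp 1) b * τ L (J0 h) (pp 2) c)
      (G := fun a b c => P1 h (pp 0) a * hh h (pp 1) b * J1 h (pp 2) (c - 1) - P1 h (pp 0) a * hh h (pp 1) b * J1 h (pp 2) c)
      (fun a b c _ _ _ => by rw [fJ _ _ (hp 2)]; ring)
    simp only [boxSum_add, boxSum_sub, boxSum_neg] at key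
    rw [hB1a, hB3a]; exact key
  have g12 : B2c - B4c = boxSum (fun a b c => P1 h (pp 0) (a - 1) * hh h (pp 1) b * J1 h (pp 2) c) (w o12)
        - boxSum (fun a b c => P1 h (pp 0) a * hh h (pp 1) b * J1 h (pp 2) c) (w o12) := by
    have key := boxSum_congr (w o12)
      (F := fun a b c => τ L (P0 h) (pp 0) a * hh h (pp 1) b * J1 h (pp 2) c - P0 h (pp 0) a * hh h (pp 1) b * J1 h (pp 2) c)
      (G := fun a b c => P1 h (pp 0) (a - 1) * hh h (pp 1) b * J1 h (pp 2) c - P1 h (pp 0) a * hh h (pp 1) b * J1 h (pp 2) c)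
      (fun a b c _ _ _ => by rw [fP _ _ (hp 0)]; ring)
    simp only [boxSum_sub] at key
    rw [hB2c, hB4c]; exact key
  have key : E - B1a - B1b + B2b + B2c + B3a + B3b - B4b - B4c = BJ + BHD := by
    rw [hD]
    calc E - B1a - B1b + B2b + B2c + B3a + B3b - B4b - B4c
        = (E - B1b + B2b + B3b - B4b) + (-B1a + B3a) + (B2c - B4c) := by abel
      _ = _ := by rw [g02, g01, g12]
      _ = _ := by abel
  -- Step D
  have hJ : ‖BJ‖ ≤ (18 / (L : ℝ) ^ 2) * Bw := by
    refine (norm_boxSum_le' _ (fun a b c _ _ _ => hw _ _)).trans (mul_le_mul_of_nonneg_right ?_ hBw)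
    refine (boxMass_le (mass_J1 h _) (mass_J0 (hp 1)) (mass_J1 h _)).trans (le_of_eq ?_)
    rw [hLr]; ring
  have hH : ‖BHD‖ ≤ 1 * Bd := by
    refine (norm_boxSum_le' _ (fun a b c ha hb hc => hd _ (natAbs_vec3_le ha hb hc))).trans (mul_le_mul_of_nonneg_right ?_ hBd)
    refine (boxMass_le (mass_P1 h _) (mass_hh (hp 1)) (mass_J1 h _)).trans ?_
    have : 3 / Lr h ≤ 1 := by rw [div_le_one (Lr_pos h), hLr]; exact_mod_cast h3
    have h0 : 0 ≤ 3 / Lr h := by have := Lr_pos h; positivity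
    nlinarith
  calc _ = ‖BJ + BHD‖ := congrArg _ (by rw [← key]; abel)
    _ ≤ ‖BJ‖ + ‖BHD‖ := norm_add_le _ _
    _ ≤ (18 / (L : ℝ) ^ 2) * Bw + 1 * Bd := add_le_add hJ hH

/-- **ROW `(1,2)` OF THE TENSOR TABLE**: `‖[edge] + rowFormC‖ ≤ (18/L²)·B_w + 1·B_d` (odd `L ≥ 3`). -/
theorem rowT12 (hodd : Odd L) (h3 : 3 ≤ L) (pp : Fin 3 → Fin L) (w : Orient 3 → (Fin 3 → ℤ) → Matrix n n ℂ) {Bw Bd : ℝ}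
    (hw : ∀ o s, ‖w o s‖ ≤ Bw)
    (hd : ∀ s : Fin 3 → ℤ, (∀ i, (s i).natAbs ≤ 1 + 1) → ‖d2 w 0 1 2 o01.2 o12.2 s‖ ≤ Bd) (hBw : 0 ≤ Bw) (hBd : 0 ≤ Bd) :
    ‖(if exbC (P := P3 L m K hL) pp 1 = true ∧ exbC (P := P3 L m K hL) pp 2 = true then w o12 0 else 0) +
        rowFormC (P := P3 L m K hL) 1 (kzT L) pp 1 2 w‖ ≤ (18 / (L : ℝ) ^ 2) * Bw + 1 * Bd := by
  set h := L / 2 with hdef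
  have h1 : 1 ≤ h := by omega
  have hodd' : 2 * h + 1 = L := by obtain ⟨t, ht⟩ := hodd; omega
  have hp : ∀ i, ((pp i : Fin L) : ℕ) ≤ 2 * h := fun i => by have := (pp i).isLt; omega
  have hLr : Lr h = L := by unfold Lr; exact_mod_cast hodd'
  have fh : ∀ (p : ℕ) (j : ℤ), p ≤ 2 * h → τ L (hh h) p j = hh h p j + (J1 h p j - P1 h p j) := fun p j hpj => by
    rw [τ_eq, ← hodd', fδ_hh h1 hpj]
  have fJ : ∀ (p : ℕ) (j : ℤ), p ≤ 2 * h → τ L (J0 h) p j = J0 h p j + (J1 h p (j - 1) - J1 h p j) := fun p j hpj => by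
    rw [τ_eq, ← hodd', fδ_J0 h1 hpj]; rfl
  have ch : ∀ (p : ℕ) (j : ℤ), hh h p (j - 1) = hh h p j + (J0 h p j - P0 h p j) := fun p j => by
    have := cΔ_hh (h := h) (p := p) j; unfold cΔ at this; linarith
  have o2 : (2:ℤ) ≤ |(2:ℤ)| := by norm_num
  have o3 : (2:ℤ) ≤ |(-3:ℤ)| := by norm_num
  -- Step A
  rw [rowFormC, edge12_eq (hL := hL) hodd]
  simp only [sum_orient3, kzT]
  rw [AnsatzS.succOff_ne pp (show (0 : Fin 3) ≠ 1 by decide), AnsatzS.succOff_ne pp (show (2 : Fin 3) ≠ 1 by decide),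
    AnsatzS.succOff_ne pp (show (0 : Fin 3) ≠ 2 by decide), AnsatzS.succOff_ne pp (show (1 : Fin 3) ≠ 2 by decide),
    AnsatzS.succOff_val_self, AnsatzS.succOff_val_self]
  simp (decide := true) only [tabT, Fin.isValue, Fin.val_one, Fin.val_two, and_self, and_true, and_false,
    if_true, if_false, Complex.ofReal_neg, neg_smul, Finset.sum_neg_distrib, Complex.ofReal_zero, zero_smul,
    Finset.sum_const_zero, add_zero, zero_add]
  rw [← hdef]
  rw [term_plain (KSupp.hh h) (KSupp.J1 h) (KSupp.J0 h), term_plain (KSupp.P0 h) (KSupp.P1 h) (KSupp.hh h),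
    term_shift1 (hL := hL) (KSupp.hh h) (KSupp.J0 h) (KSupp.J1 h), term_shift1 (hL := hL) (KSupp.P0 h) (KSupp.hh h) (KSupp.J1 h),
    term_shift2 (hL := hL) (KSupp.hh h) (KSupp.J1 h) (KSupp.J0 h), term_shift2 (hL := hL) (KSupp.P0 h) (KSupp.P1 h) (KSupp.hh h),
    term_plain (KSupp.hh h) (KSupp.J0 h) (KSupp.J1 h), term_plain (KSupp.P0 h) (KSupp.hh h) (KSupp.J1 h)]
  -- Step B
  set E := boxSum (fun a b c => P0 h (pp 0) a * P1 h (pp 1) b * P1 h (pp 2) c) (w o12) with hE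
  set B1a := boxSum (fun a b c => hh h (pp 0) a * J1 h (pp 1) b * J0 h (pp 2) c) (w o01) with hB1a
  set B1c := boxSum (fun a b c => P0 h (pp 0) a * P1 h (pp 1) b * hh h (pp 2) c) (w o12) with hB1c
  set B2b := boxSum (fun a b c => hh h (pp 0) a * τ L (J0 h) (pp 1) b * J1 h (pp 2) c) (w o02) with hB2b
  set B2c := boxSum (fun a b c => P0 h (pp 0) a * τ L (hh h) (pp 1) b * J1 h (pp 2) c) (w o12) with hB2c
  set B3a := boxSum (fun a b c => hh h (pp 0) a * J1 h (pp 1) b * τ L (J0 h) (pp 2) c) (w o01) with hB3a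
  set B3c := boxSum (fun a b c => P0 h (pp 0) a * P1 h (pp 1) b * τ L (hh h) (pp 2) c) (w o12) with hB3c
  set B4b := boxSum (fun a b c => hh h (pp 0) a * J0 h (pp 1) b * J1 h (pp 2) c) (w o02) with hB4b
  set B4c := boxSum (fun a b c => P0 h (pp 0) a * hh h (pp 1) b * J1 h (pp 2) c) (w o12) with hB4c
  set BJ := boxSum (fun a b c => J0 h (pp 0) a * J1 h (pp 1) b * J1 h (pp 2) c) (w o12) with hBJ
  set BHD := boxSum (fun a b c => hh h (pp 0) a * J1 h (pp 1) b * J1 h (pp 2) c) (fun v => d2 w 0 1 2 o01.2 o12.2 v) with hBHD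
  have hD : BHD = boxSum (fun a b c => hh h (pp 0) (a - 1) * J1 h (pp 1) b * J1 h (pp 2) c) (w o12)
      - boxSum (fun a b c => hh h (pp 0) a * J1 h (pp 1) b * J1 h (pp 2) c) (w o12)
      - (boxSum (fun a b c => hh h (pp 0) a * J1 h (pp 1) (b - 1) * J1 h (pp 2) c) (w o02)
        - boxSum (fun a b c => hh h (pp 0) a * J1 h (pp 1) b * J1 h (pp 2) c) (w o02))
      + (boxSum (fun a b c => hh h (pp 0) a * J1 h (pp 1) b * J1 h (pp 2) (c - 1)) (w o01)
        - boxSum (fun a b c => hh h (pp 0) a * J1 h (pp 1) b * J1 h (pp 2) c) (w o01)) := by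
    rw [hBHD, boxSum_d2' _ w (fun b c => by simp [KSupp.hh h _ _ o2]) (fun b c => by simp [KSupp.hh h _ _ o3])
      (fun a c => by simp [KSupp.J1 h _ _ o2]) (fun a c => by simp [KSupp.J1 h _ _ o3])
      (fun a b => by simp [KSupp.J1 h _ _ o2]) (fun a b => by simp [KSupp.J1 h _ _ o3])]
    simp only [boxSum_sub]
  -- Step C
  have g12 : E - B1c + B2c + B3c - B4c = BJ - (boxSum (fun a b c => hh h (pp 0) (a - 1) * J1 h (pp 1) b * J1 h (pp 2) c) (w o12)
        - boxSum (fun a b c => hh h (pp 0) a * J1 h (pp 1) b * J1 h (pp 2) c) (w o12)) := by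
    have key := boxSum_congr (w o12)
      (F := fun a b c => P0 h (pp 0) a * P1 h (pp 1) b * P1 h (pp 2) c - P0 h (pp 0) a * P1 h (pp 1) b * hh h (pp 2) c
        + P0 h (pp 0) a * τ L (hh h) (pp 1) b * J1 h (pp 2) c + P0 h (pp 0) a * P1 h (pp 1) b * τ L (hh h) (pp 2) c
        - P0 h (pp 0) a * hh h (pp 1) b * J1 h (pp 2) c)
      (G := fun a b c => J0 h (pp 0) a * J1 h (pp 1) b * J1 h (pp 2) c
        - (hh h (pp 0) (a - 1) * J1 h (pp 1) b * J1 h (pp 2) c - hh h (pp 0) a * J1 h (pp 1) b * J1 h (pp 2) c))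
      (fun a b c _ _ _ => by rw [fh _ _ (hp 1), fh _ _ (hp 2), ch]; ring)
    simp only [boxSum_add, boxSum_sub] at key
    rw [hE, hB1c, hB2c, hB3c, hB4c, hBJ]; exact key
  have g01 : B1a - B3a = -(boxSum (fun a b c => hh h (pp 0) a * J1 h (pp 1) b * J1 h (pp 2) (c - 1)) (w o01)
        - boxSum (fun a b c => hh h (pp 0) a * J1 h (pp 1) b * J1 h (pp 2) c) (w o01)) := by
    have key := boxSum_congr (w o01)
      (F := fun a b c => hh h (pp 0) a * J1 h (pp 1) b * J0 h (pp 2) c - hh h (pp 0) a * J1 h (pp 1) b * τ L (J0 h) (pp 2) c)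
      (G := fun a b c => -(hh h (pp 0) a * J1 h (pp 1) b * J1 h (pp 2) (c - 1) - hh h (pp 0) a * J1 h (pp 1) b * J1 h (pp 2) c))
      (fun a b c _ _ _ => by rw [fJ _ _ (hp 2)]; ring)
    simp only [boxSum_sub, boxSum_neg] at key
    rw [hB1a, hB3a]; exact key
  have g02 : B2b - B4b = boxSum (fun a b c => hh h (pp 0) a * J1 h (pp 1) (b - 1) * J1 h (pp 2) c) (w o02)
        - boxSum (fun a b c => hh h (pp 0) a * J1 h (pp 1) b * J1 h (pp 2) c) (w o02) := by
    have key := boxSum_congr (w o02)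
      (F := fun a b c => hh h (pp 0) a * τ L (J0 h) (pp 1) b * J1 h (pp 2) c - hh h (pp 0) a * J0 h (pp 1) b * J1 h (pp 2) c)
      (G := fun a b c => hh h (pp 0) a * J1 h (pp 1) (b - 1) * J1 h (pp 2) c - hh h (pp 0) a * J1 h (pp 1) b * J1 h (pp 2) c)
      (fun a b c _ _ _ => by rw [fJ _ _ (hp 1)]; ring)
    simp only [boxSum_sub] at key
    rw [hB2b, hB4b]; exact key
  have key : E + B1a - B1c + B2b + B2c - B3a + B3c - B4b - B4c = BJ - BHD := by
    rw [hD]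
    calc E + B1a - B1c + B2b + B2c - B3a + B3c - B4b - B4c
        = (E - B1c + B2c + B3c - B4c) + (B1a - B3a) + (B2b - B4b) := by abel
      _ = _ := by rw [g12, g01, g02]
      _ = _ := by abel
  -- Step D
  have hJ : ‖BJ‖ ≤ (18 / (L : ℝ) ^ 2) * Bw := by
    refine (norm_boxSum_le' _ (fun a b c _ _ _ => hw _ _)).trans (mul_le_mul_of_nonneg_right ?_ hBw)
    refine (boxMass_le (mass_J0 (hp 0)) (mass_J1 h _) (mass_J1 h _)).trans (le_of_eq ?_)
    rw [hLr]; ring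
  have hH : ‖BHD‖ ≤ 1 * Bd := by
    refine (norm_boxSum_le' _ (fun a b c ha hb hc => hd _ (natAbs_vec3_le ha hb hc))).trans (mul_le_mul_of_nonneg_right ?_ hBd)
    refine (boxMass_le (mass_hh (hp 0)) (mass_J1 h _) (mass_J1 h _)).trans ?_
    have : 3 / Lr h ≤ 1 := by rw [div_le_one (Lr_pos h), hLr]; exact_mod_cast h3
    have h0 : 0 ≤ 3 / Lr h := by have := Lr_pos h; positivity
    nlinarith
  calc _ = ‖BJ - BHD‖ := congrArg _ (by rw [← key]; abel)
    _ ≤ ‖BJ‖ + ‖BHD‖ := norm_sub_le _ _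
    _ ≤ (18 / (L : ℝ) ^ 2) * Bw + 1 * Bd := add_le_add hJ hH

end Rows

end Summit.QuantumFields.YangMills.Theorems.ApproxLift.AnsatzT

end
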